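import Literature.MathematicalPhysics.QuantumFieldTheory.DurhuusFrohlichSlabCriterionProofs
import Literature.MathematicalPhysics.QuantumFieldTheory.SUNBakryEmeryPoincare
import HarnessLib

/-!
# Robust ball (Y2), area-law side, part 1a — the PERTURBED Wilson weight and its slab laws

HONEST FRAMING: venture file of the cell `pub-ymgap` (QuantumFields programme), track ROBUST-BALL. It generalises the
slab disintegration of `DurhuusFrohlichSlabCriterionProofs` (Cao–Nissim–Sheffield arXiv:2509.04688 §2, the «conditioning on
the links orthogonal to the vertical side») from the Wilson weight `exp(-Nβ S_W(U))` to a PERTURBED weight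
`exp(-Nβ S_W(U)) · exp(-W(U))` for an ARBITRARY bounded measurable `W : GaugeConfig (n+1) L (SU N) → ℝ` (later the total
`W.total` of a quasi-local gauge-invariant perturbation, `QuasiLocalGaugePerturbation`, i.e. a member of the robust ball).
Finite-torus, strong-coupling bookkeeping only: no statement about area laws, mass gaps or the continuum is made in this file.

Contents: public versions of the gluing facts of the tree file, the perturbed weight `weightW`, the perturbed slab law
`slabLawW v t β W r` (product Haar on the vertical links of the slab `{x_v = t}` tilted by `S_{A(r),B(r)}(Q) - W(glue Q r)` — the
WHOLE perturbation goes into the tilt, so no splitting of `W` into slab / off-slab parts is needed), its partition function and the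
off-slab weight `slabWeightW`, with measurability / boundedness / positivity.  The disintegration itself is part 1b
(`RobustSlabDisintegration`).  At `W = 0` everything is the tree's (`weightW_zero`, `slabLawW_zero`).  (The import of
`SUNBakryEmeryPoincare` only supplies the instance `SecondCountableTopology SU(N)` needed for product measurability.)

References: Cao–Nissim–Sheffield arXiv:2509.04688v2 §2 (Def. 2.1, proof of Thm. 2.3); Durhuus–Fröhlich CMP 75 (1980).
-/

noncomputable section

open MeasureTheory
open Literature.MathematicalPhysics.QuantumLattice (fundamentalRep continuous_fundamentalRep fundamentalRep_apply)
open Literature.MathematicalPhysics.QuantumFieldTheory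
open Literature.MathematicalPhysics.QuantumFieldTheory.DurhuusFrohlich

namespace Summit.Ventures.YMGap.RobustBall

variable {n L N : ℕ}

/-! ### Small facts about gluing (the tree's are private) -/

section Glue

variable {G : Type*}

/-- Gluing, evaluated on a vertical slab edge. [folklore] -/
@[simp] theorem glue_ins (v : Fin (n + 1)) (t : ZMod L) (Q : Site n L → G)
    (r : {e : Edge (n + 1) L // ¬ IsSlab v t e} → G) (x : Site n L) :
    glue v t Q r (ins v t x, v) = Q x := by
  have h : IsSlab v t (ins v t x, v) := ⟨rfl, by simp [ins]⟩
  simp only [glue, h, dite_true]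
  show Q (rem v (ins v t x)) = Q x
  congr 1
  funext k; simp [rem, ins]

/-- Gluing, evaluated on a slab edge. [folklore] -/
theorem glue_of_isSlab (v : Fin (n + 1)) (t : ZMod L) (Q : Site n L → G)
    (r : {e : Edge (n + 1) L // ¬ IsSlab v t e} → G) {e : Edge (n + 1) L} (h : IsSlab v t e) :
    glue v t Q r e = Q (rem v e.1) := by
  simp [glue, h]

/-- Gluing, evaluated off the slab. [folklore] -/
theorem glue_of_not_isSlab (v : Fin (n + 1)) (t : ZMod L) (Q : Site n L → G)
    (r : {e : Edge (n + 1) L // ¬ IsSlab v t e} → G) {e : Edge (n + 1) L} (h : ¬ IsSlab v t e) :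
    glue v t Q r e = r ⟨e, h⟩ := by
  simp [glue, h]

/-- The slab part of a glued configuration. [folklore] -/
@[simp] theorem slabPart_glue (v : Fin (n + 1)) (t : ZMod L) (Q : Site n L → G)
    (r : {e : Edge (n + 1) L // ¬ IsSlab v t e} → G) : slabPart v t (glue v t Q r) = Q := by
  funext x; simp [slabPart]

/-- The rest part of a glued configuration. [folklore] -/
@[simp] theorem restPart_glue (v : Fin (n + 1)) (t : ZMod L) (Q : Site n L → G)
    (r : {e : Edge (n + 1) L // ¬ IsSlab v t e} → G) : restPart v t (glue v t Q r) = r := by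
  funext e; simp [restPart, glue_of_not_isSlab v t Q r e.2]

/-- `ins v (y v) (rem v y) = y`. [folklore] -/
theorem ins_rem (v : Fin (n + 1)) (y : Site (n + 1) L) : ins v (y v) (rem v y) = y := by
  funext j
  rcases Fin.eq_self_or_eq_succAbove v j with rfl | ⟨k, rfl⟩
  · simp [ins]
  · simp [ins, rem]

/-- Gluing the two parts of a configuration gives it back. [folklore] -/
@[simp] theorem glue_slabPart_restPart (v : Fin (n + 1)) (t : ZMod L) (U : GaugeConfig (n + 1) L G) :
    glue v t (slabPart v t U) (restPart v t U) = U := by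
  funext e
  by_cases h : IsSlab v t e
  · rw [glue_of_isSlab v t _ _ h]
    obtain ⟨y, w⟩ := e
    obtain ⟨hw, hy⟩ := h
    simp only at hw hy
    subst hw; subst hy
    simp [slabPart, ins_rem]
  · rw [glue_of_not_isSlab v t _ _ h]; rfl

/-- Off the slab, a configuration glued from `restPart U` agrees with `U`. [folklore] -/
theorem glue_restPart_of_not_isSlab (v : Fin (n + 1)) (t : ZMod L) {U : GaugeConfig (n + 1) L G}
    (Q : Site n L → G) {e : Edge (n + 1) L} (h : ¬ IsSlab v t e) :
    glue v t Q (restPart v t U) e = U e := by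
  rw [glue_of_not_isSlab v t _ _ h]; rfl

/-- Two glued configurations with the same rest agree off the slab. [folklore] -/
theorem glue_eq_glue_of_not_isSlab (v : Fin (n + 1)) (t : ZMod L) (Q Q' : Site n L → G)
    (r : {e : Edge (n + 1) L // ¬ IsSlab v t e} → G) {e : Edge (n + 1) L} (h : ¬ IsSlab v t e) :
    glue v t Q r e = glue v t Q' r e := by
  rw [glue_of_not_isSlab v t _ _ h, glue_of_not_isSlab v t _ _ h]

variable [MeasurableSpace G]

/-- Gluing is measurable in the pair (slab configuration, rest). [folklore] -/
theorem measurable_glue (v : Fin (n + 1)) (t : ZMod L) :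
    Measurable fun p : (Site n L → G) × ({e : Edge (n + 1) L // ¬ IsSlab v t e} → G) =>
      glue v t p.1 p.2 :=
  (splitEquiv (G := G) v t).symm.measurable

/-- The rest part is a measurable function of the configuration. [folklore] -/
theorem measurable_restPart (v : Fin (n + 1)) (t : ZMod L) :
    Measurable (restPart (G := G) (L := L) v t) :=
  measurable_pi_lambda _ fun _ => measurable_pi_apply _

/-- The slab part is a measurable function of the configuration. [folklore] -/
theorem measurable_slabPart (v : Fin (n + 1)) (t : ZMod L) :
    Measurable (slabPart (G := G) (L := L) v t) :=
  measurable_pi_lambda _ fun _ => measurable_pi_apply _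

end Glue

/-! ### The perturbed weight and the perturbed slab law -/

section Peel

variable [NeZero L]

/-- The unperturbed 't Hooft-scaled Boltzmann weight is measurable. [folklore] -/
theorem measurable_weight (β : ℝ) : Measurable (weight (n := n) (L := L) N β) :=
  Real.measurable_exp.comp ((WilsonRP.measurable_wilsonAction (fundamentalRep (Fin N))
    (continuous_fundamentalRep (Fin N))).const_mul _)

/-- The unperturbed Boltzmann weight is bounded. [folklore] -/
theorem exists_weight_le (β : ℝ) : ∃ C, ∀ U : GaugeConfig (n + 1) L (SU N), weight N β U ≤ C := by
  obtain ⟨B, hB⟩ := exists_abs_wilsonAction_le (d := n + 1) (L := L) (fundamentalRep (Fin N))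
    (continuous_fundamentalRep (Fin N))
  refine ⟨Real.exp (|(N : ℝ) * β| * B), fun U => Real.exp_le_exp.2 ?_⟩
  have h1 : -((N : ℝ) * β) * wilsonAction (fundamentalRep (Fin N)) U ≤
      |-((N : ℝ) * β) * wilsonAction (fundamentalRep (Fin N)) U| := le_abs_self _
  rw [abs_mul, abs_neg] at h1
  exact h1.trans (mul_le_mul_of_nonneg_left (hB U) (abs_nonneg _))

variable (W : GaugeConfig (n + 1) L (SU N) → ℝ)

/-- **The perturbed Boltzmann weight** `exp(-Nβ S_W(U) - W(U))` ('t Hooft coupling `β`, tree coupling `Nβ`): the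
density, with respect to product Haar measure, of the lattice gauge theory with action `Nβ S_W + W`
(`QuasiLocalGaugePerturbation.weight` with `β' = Nβ` when `W` is the total of a quasi-local perturbation). [folklore] -/
def weightW (N : ℕ) (β : ℝ) (W : GaugeConfig (n + 1) L (SU N) → ℝ) (U : GaugeConfig (n + 1) L (SU N)) : ℝ :=
  Real.exp (-((N : ℝ) * β) * wilsonAction (fundamentalRep (Fin N)) U - W U)

/-- The perturbed weight is the Wilson weight times `exp(-W)`. [folklore] -/
theorem weightW_eq_mul (β : ℝ) (U : GaugeConfig (n + 1) L (SU N)) :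
    weightW N β W U = weight N β U * Real.exp (-W U) := by
  rw [weightW, weight, sub_eq_add_neg, Real.exp_add]

/-- At `W = 0` the perturbed weight is the Wilson weight. [folklore] -/
@[simp] theorem weightW_zero (β : ℝ) (U : GaugeConfig (n + 1) L (SU N)) :
    weightW N β (fun _ => 0) U = weight N β U := by
  simp [weightW, weight]

/-- The perturbed weight is positive. [folklore] -/
theorem weightW_pos (β : ℝ) (U : GaugeConfig (n + 1) L (SU N)) : 0 < weightW N β W U := Real.exp_pos _

variable {W}

/-- The perturbed weight is measurable. [folklore] -/
theorem measurable_weightW (β : ℝ) (hWm : Measurable W) : Measurable (weightW (n := n) (L := L) N β W) :=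
  Real.measurable_exp.comp (((WilsonRP.measurable_wilsonAction (fundamentalRep (Fin N))
    (continuous_fundamentalRep (Fin N))).const_mul _).sub hWm)

/-- The perturbed weight is bounded. [folklore] -/
theorem exists_weightW_le (β : ℝ) (hWb : ∃ C, ∀ U, |W U| ≤ C) :
    ∃ C, ∀ U : GaugeConfig (n + 1) L (SU N), weightW N β W U ≤ C := by
  obtain ⟨Cw, hCw⟩ := exists_weight_le (n := n) (L := L) (N := N) β
  obtain ⟨CW, hCW⟩ := hWb
  refine ⟨Cw * Real.exp CW, fun U => ?_⟩
  have h1 : Real.exp (-W U) ≤ Real.exp CW := Real.exp_le_exp.2 ((neg_le_abs _).trans (hCW U))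
  rw [weightW_eq_mul]
  exact mul_le_mul (hCw U) h1 (Real.exp_pos _).le ((Real.exp_pos _).le.trans (hCw U))

/-- The perturbed weight is integrable. [folklore] -/
theorem integrable_weightW (β : ℝ) (hWm : Measurable W) (hWb : ∃ C, ∀ U, |W U| ≤ C) :
    Integrable (weightW N β W) (linkMeasure n L N) := by
  obtain ⟨C, hC⟩ := exists_weightW_le (n := n) (L := L) (N := N) β hWb
  exact Integrable.of_bound (measurable_weightW β hWm).aestronglyMeasurable C
    (ae_of_all _ fun U => by rw [Real.norm_eq_abs, abs_of_pos (weightW_pos W β U)]; exact hC U)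

/-- The perturbed weight has positive total mass. [folklore] -/
theorem integral_weightW_pos (β : ℝ) (hWm : Measurable W) (hWb : ∃ C, ∀ U, |W U| ≤ C) :
    0 < ∫ U, weightW N β W U ∂(linkMeasure n L N) := by
  unfold weightW
  exact integral_exp_pos (by have h := integrable_weightW (n := n) (L := L) (N := N) β hWm hWb; exact h)

variable (W)

/-- The exponent of the perturbed slab law: `S_{A(r),B(r)}(Q) - W(glue Q r)`. [folklore] -/
def slabTiltW (v : Fin (n + 1)) (t : ZMod L) (β : ℝ) (W : GaugeConfig (n + 1) L (SU N) → ℝ)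
    (r : {e : Edge (n + 1) L // ¬ IsSlab v t e} → SU N) (Q : Site n L → SU N) : ℝ :=
  slabActionOf v t β (glue v t Q r) - W (glue v t Q r)

/-- **The perturbed slab law** of the slab `{x_v = t}` given the off-slab links `r`: product Haar measure on the vertical
links tilted by `S_{A(r),B(r)}(Q) - W(glue Q r)` (the slab `σ`-model of CNS Def. 2.1, re-weighted by `exp(-W)`; off-slab terms
of `W` are constant in `Q` and drop out of the normalisation). [cite: CaoNissimSheffield2025dynamical, Definition 2.1] -/
def slabLawW (v : Fin (n + 1)) (t : ZMod L) (β : ℝ) (W : GaugeConfig (n + 1) L (SU N) → ℝ)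
    (r : {e : Edge (n + 1) L // ¬ IsSlab v t e} → SU N) : Measure (Site n L → SU N) :=
  (sliceMeasure n L N).tilted (slabTiltW v t β W r)

/-- The perturbed slab partition function `∫ exp(S_{A(r),B(r)}(Q) - W(glue Q r)) dQ`. [folklore] -/
def slabZW (v : Fin (n + 1)) (t : ZMod L) (β : ℝ) (W : GaugeConfig (n + 1) L (SU N) → ℝ)
    (r : {e : Edge (n + 1) L // ¬ IsSlab v t e} → SU N) : ℝ :=
  ∫ Q, Real.exp (slabTiltW v t β W r Q) ∂(sliceMeasure n L N)

/-- The weight of the off-slab configuration `r` after integrating out the slab: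
`exp(-Nβ S_rest(r)) exp(-Nβ N |E(Λ^n)|) Z^W_{r}`. [folklore] -/
def slabWeightW (v : Fin (n + 1)) (t : ZMod L) (β : ℝ) (W : GaugeConfig (n + 1) L (SU N) → ℝ)
    (r : {e : Edge (n + 1) L // ¬ IsSlab v t e} → SU N) : ℝ :=
  Real.exp (-((N : ℝ) * β) * restAction v t (glue v t (fun _ => 1) r)) *
    Real.exp (-((N : ℝ) * β) * ((N : ℝ) * Fintype.card (Edge n L))) * slabZW v t β W r

variable {W}

/-- The slab action read off a configuration, as `Nβ` times the sum of the edge terms. [folklore] -/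
theorem slabActionOf_eq_sum_edgeTerm (v : Fin (n + 1)) (t : ZMod L) (β : ℝ) (U : GaugeConfig (n + 1) L (SU N)) :
    slabActionOf v t β U = (N : ℝ) * β * ∑ e, edgeTerm v t U e := by
  unfold slabActionOf slabAction edgeTerm
  rfl

omit [NeZero L] in
/-- Coercion of `toU g`. [folklore] -/
@[simp] theorem coe_toU' (g : SU N) : ((toU g : UN N) : Matrix (Fin N) (Fin N) ℂ) = g := rfl

omit [NeZero L] in
/-- Coercion of `(toU g)⁻¹` is the adjoint matrix. [folklore] -/
@[simp] theorem coe_toU_inv' (g : SU N) :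
    (((toU g)⁻¹ : UN N) : Matrix (Fin N) (Fin N) ℂ) = star (g : Matrix (Fin N) (Fin N) ℂ) := rfl

omit [NeZero L] in
/-- Coercion of `g⁻¹` in `SU(N)` is the adjoint matrix. [folklore] -/
theorem coe_inv_SU' (g : SU N) : ((g⁻¹ : SU N) : Matrix (Fin N) (Fin N) ℂ) = star (g : Matrix (Fin N) (Fin N) ℂ) := rfl

omit [NeZero L] in
/-- Edge terms are continuous in the configuration. [folklore] -/
theorem continuous_edgeTerm (v : Fin (n + 1)) (t : ZMod L) (e : Edge n L) :
    Continuous fun U : GaugeConfig (n + 1) L (SU N) => edgeTerm v t U e := by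
  unfold edgeTerm slabPart topField botField
  simp only [coe_toU', coe_toU_inv', coe_inv_SU']
  refine Complex.continuous_re.comp (Continuous.matrix_trace ?_)
  refine Continuous.mul (Continuous.mul (Continuous.mul ?_ ?_) ?_) ?_
  · exact continuous_subtype_val.comp (continuous_apply _)
  · exact continuous_subtype_val.comp (continuous_apply _)
  · exact (continuous_subtype_val.comp (continuous_apply _)).star
  · exact (continuous_subtype_val.comp (continuous_apply _)).star

omit [NeZero L] in
/-- `|Re Tr(unitary)| ≤ N` for an edge term. [folklore] -/
theorem abs_edgeTerm_le (v : Fin (n + 1)) (t : ZMod L) (U : GaugeConfig (n + 1) L (SU N)) (e : Edge n L) :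
    |edgeTerm v t U e| ≤ N := by
  unfold edgeTerm
  set M : Matrix (Fin N) (Fin N) ℂ := ((slabPart v t U e.1 : SU N) : Matrix (Fin N) (Fin N) ℂ) *
    (topField v t U e : Matrix (Fin N) (Fin N) ℂ) * ((slabPart v t U (e.1.shift e.2))⁻¹ : SU N) *
      ((botField v t U e)⁻¹ : UN N) with hM
  have hMu : M ∈ Matrix.unitaryGroup (Fin N) ℂ := by
    rw [hM]
    refine Submonoid.mul_mem _ (Submonoid.mul_mem _ (Submonoid.mul_mem _ ?_ (topField v t U e).2) ?_)
      ((botField v t U e)⁻¹).2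
    · exact (slabPart v t U e.1).2.1
    · exact ((slabPart v t U (e.1.shift e.2))⁻¹).2.1
  have hentry : ∀ i j, ‖M i j‖ ≤ 1 := fun i j => entry_norm_bound_of_unitary hMu i j
  calc |(M.trace).re| ≤ ‖M.trace‖ := Complex.abs_re_le_norm _
    _ = ‖∑ i, M i i‖ := by rw [Matrix.trace]; rfl
    _ ≤ ∑ i, ‖M i i‖ := norm_sum_le _ _
    _ ≤ ∑ _i : Fin N, (1 : ℝ) := Finset.sum_le_sum fun i _ => hentry i i
    _ = N := by simp

/-- The slab action read off a configuration is measurable. [folklore] -/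
theorem measurable_slabActionOf (v : Fin (n + 1)) (t : ZMod L) (β : ℝ) :
    Measurable (slabActionOf (n := n) (L := L) (N := N) v t β) := by
  have h : slabActionOf (n := n) (L := L) (N := N) v t β = fun U => (N : ℝ) * β * ∑ e, edgeTerm v t U e :=
    funext fun U => slabActionOf_eq_sum_edgeTerm v t β U
  rw [h]
  exact (continuous_const.mul (continuous_finsetSum _ fun e _ => continuous_edgeTerm v t e)).measurable

/-- `|S_{A,B}(Q)| ≤ N|β| · N |E(Λ^n)|` for the slab action read off a configuration. [folklore] -/
theorem abs_slabActionOf_le (v : Fin (n + 1)) (t : ZMod L) (β : ℝ) (U : GaugeConfig (n + 1) L (SU N)) :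
    |slabActionOf v t β U| ≤ (N : ℝ) * |β| * ((N : ℝ) * Fintype.card (Edge n L)) := by
  rw [slabActionOf_eq_sum_edgeTerm, abs_mul, abs_mul, Nat.abs_cast]
  refine mul_le_mul_of_nonneg_left ?_ (by positivity)
  refine (Finset.abs_sum_le_sum_abs _ _).trans ?_
  calc ∑ e, |edgeTerm v t U e| ≤ ∑ _e : Edge n L, (N : ℝ) := Finset.sum_le_sum fun e _ => abs_edgeTerm_le v t U e
    _ = (N : ℝ) * Fintype.card (Edge n L) := by simp [mul_comm]

omit [NeZero L] in
/-- Gluing with a fixed rest is measurable in the slab configuration. [folklore] -/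
theorem measurable_glue_left {G : Type*} [MeasurableSpace G] (v : Fin (n + 1)) (t : ZMod L)
    (r : {e : Edge (n + 1) L // ¬ IsSlab v t e} → G) : Measurable fun Q : Site n L → G => glue v t Q r := by
  refine measurable_pi_lambda _ fun e => ?_
  by_cases h : IsSlab v t e
  · simp only [glue, h, dite_true]; exact measurable_pi_apply _
  · simp only [glue, h, dite_false]; exact measurable_const

/-- The tilt exponent is measurable in the pair (slab configuration, rest). [folklore] -/
theorem measurable_slabTiltW_uncurry (v : Fin (n + 1)) (t : ZMod L) (β : ℝ) (hWm : Measurable W) :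
    Measurable fun p : (Site n L → SU N) × ({e : Edge (n + 1) L // ¬ IsSlab v t e} → SU N) =>
      slabTiltW v t β W p.2 p.1 := by
  unfold slabTiltW
  exact ((measurable_slabActionOf v t β).comp (measurable_glue v t)).sub (hWm.comp (measurable_glue v t))

/-- The tilt exponent is measurable in the slab configuration. [folklore] -/
theorem measurable_slabTiltW (v : Fin (n + 1)) (t : ZMod L) (β : ℝ) (hWm : Measurable W)
    (r : {e : Edge (n + 1) L // ¬ IsSlab v t e} → SU N) : Measurable (slabTiltW v t β W r) := by
  unfold slabTiltW
  exact ((measurable_slabActionOf v t β).comp (measurable_glue_left v t r)).sub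
    (hWm.comp (measurable_glue_left v t r))

/-- The tilt exponent is bounded, uniformly in the rest. [folklore] -/
theorem abs_slabTiltW_le (v : Fin (n + 1)) (t : ZMod L) (β : ℝ) {CW : ℝ} (hCW : ∀ U, |W U| ≤ CW)
    (r : {e : Edge (n + 1) L // ¬ IsSlab v t e} → SU N) (Q : Site n L → SU N) :
    |slabTiltW v t β W r Q| ≤ (N : ℝ) * |β| * ((N : ℝ) * Fintype.card (Edge n L)) + CW := by
  unfold slabTiltW
  exact (abs_sub _ _).trans (add_le_add (abs_slabActionOf_le v t β _) (hCW _))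

/-- `exp` of the tilt exponent is integrable for product Haar measure on the slab. [folklore] -/
theorem integrable_exp_slabTiltW (v : Fin (n + 1)) (t : ZMod L) (β : ℝ) (hWm : Measurable W)
    (hWb : ∃ C, ∀ U, |W U| ≤ C) (r : {e : Edge (n + 1) L // ¬ IsSlab v t e} → SU N) :
    Integrable (fun Q => Real.exp (slabTiltW v t β W r Q)) (sliceMeasure n L N) := by
  obtain ⟨CW, hCW⟩ := hWb
  refine Integrable.of_bound ?_ (Real.exp ((N : ℝ) * |β| * ((N : ℝ) * Fintype.card (Edge n L)) + CW))
    (ae_of_all _ fun Q => ?_)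
  · exact (Real.measurable_exp.comp (measurable_slabTiltW v t β hWm r)).aestronglyMeasurable
  · rw [Real.norm_eq_abs, Real.abs_exp]
    exact Real.exp_le_exp.2 ((le_abs_self _).trans (abs_slabTiltW_le v t β hCW r Q))

/-- The perturbed slab partition function is positive. [folklore] -/
theorem slabZW_pos (v : Fin (n + 1)) (t : ZMod L) (β : ℝ) (hWm : Measurable W) (hWb : ∃ C, ∀ U, |W U| ≤ C)
    (r : {e : Edge (n + 1) L // ¬ IsSlab v t e} → SU N) : 0 < slabZW v t β W r :=
  integral_exp_pos (integrable_exp_slabTiltW v t β hWm hWb r)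

/-- The perturbed slab law is a probability measure (for bounded measurable `W`). [folklore] -/
theorem isProbabilityMeasure_slabLawW (v : Fin (n + 1)) (t : ZMod L) (β : ℝ) (hWm : Measurable W)
    (hWb : ∃ C, ∀ U, |W U| ≤ C) (r : {e : Edge (n + 1) L // ¬ IsSlab v t e} → SU N) :
    IsProbabilityMeasure (slabLawW v t β W r) := by
  unfold slabLawW
  exact isProbabilityMeasure_tilted (integrable_exp_slabTiltW v t β hWm hWb r)

omit [NeZero L] in
/-- The top boundary field does not see the slab. [folklore] -/
theorem topField_glue' (v : Fin (n + 1)) (t : ZMod L) (Q : Site n L → SU N)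
    (r : {e : Edge (n + 1) L // ¬ IsSlab v t e} → SU N) :
    topField v t (glue v t Q r) = topField v t (glue v t (fun _ => 1) r) := by
  funext e
  have h : ¬ IsSlab v t (ins v (t + 1) e.1, v.succAbove e.2) := fun h => Fin.succAbove_ne v e.2 h.1
  simp only [topField, glue_of_not_isSlab v t _ _ h]

omit [NeZero L] in
/-- The bottom boundary field does not see the slab. [folklore] -/
theorem botField_glue' (v : Fin (n + 1)) (t : ZMod L) (Q : Site n L → SU N)
    (r : {e : Edge (n + 1) L // ¬ IsSlab v t e} → SU N) :
    botField v t (glue v t Q r) = botField v t (glue v t (fun _ => 1) r) := by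
  funext e
  have h : ¬ IsSlab v t (ins v t e.1, v.succAbove e.2) := fun h => Fin.succAbove_ne v e.2 h.1
  simp only [botField, glue_of_not_isSlab v t _ _ h]

/-- The slab action of a glued configuration is `S_{A(r),B(r)}(Q)`. [folklore] -/
theorem slabActionOf_glue (v : Fin (n + 1)) (t : ZMod L) (β : ℝ) (Q : Site n L → SU N)
    (r : {e : Edge (n + 1) L // ¬ IsSlab v t e} → SU N) :
    slabActionOf v t β (glue v t Q r) =
      slabAction N β (topField v t (glue v t (fun _ => 1) r)) (botField v t (glue v t (fun _ => 1) r)) Q := by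
  rw [slabActionOf, topField_glue' v t Q r, botField_glue' v t Q r, slabPart_glue]

/-- At `W = 0` the perturbed slab law is the tree's slab law `slabLaw v t β r`. [folklore] -/
theorem slabLawW_zero (v : Fin (n + 1)) (t : ZMod L) (β : ℝ) (r : {e : Edge (n + 1) L // ¬ IsSlab v t e} → SU N) :
    slabLawW v t β (fun _ => 0) r = slabLaw v t β r := by
  rw [slabLawW, slabLaw, slabMeasure]
  have h : slabTiltW v t β (fun _ => (0 : ℝ)) r =
      slabAction N β (topField v t (glue v t (fun _ => 1) r)) (botField v t (glue v t (fun _ => 1) r)) := by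
    funext Q; simp [slabTiltW, slabActionOf_glue]
  rw [h]

end Peel

end Summit.Ventures.YMGap.RobustBall
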